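import Literature.AnabelianGeometry.EtaleTheta.SettingModelKummerCocycleP
import Literature.AnabelianGeometry.EtaleTheta.SettingModelCyclotomicCharacterLevelNontrivial
import Mathlib.NumberTheory.GaussSum
import Mathlib.NumberTheory.LegendreSymbol.QuadraticChar.Basic
import HarnessLib

/-!
# `√p ∈ ℚ_p(μ_{4p})`: the level-`2` Kummer class `κ_p mod 2` of `q̈ = p` is a function of the mod-`4p`
# cyclotomic character (classical; Gauss sums)

Classical input for the abc-iut cell's K-L6 residual row «THM16I-ODDPARITY-Γ@p≡3(4)» (successor item (iii)
of abc-iut-L6-d6's «THM16I-NONINNER-AT-MODELTATE», memo `HOME/staging/L6/L6-d6/g6/THM16I-NONINNER-AT-MODELTATE.md`):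
there the residual of [EtTh] Thm. 1.6 (i) at the stage-2 Tate model `modelχq p i 2` is the equality
`κ₂(σ) = κ₂(ν σ)` for the automorphism `ν` of `G_{ℚ_p}` induced by a `Δ`-stabilising `Γ`; the present file supplies
the number theory that turns `χ ∘ ν = χ` (level-wise) into that equality.

K. Ireland, M. Rosen, *A Classical Introduction to Modern Number Theory*, Ch. 6 §3 Prop. 6.3.2 (the quadratic
Gauss sum `g = Σ_a (a|p) ζ_p^a` has `g² = (−1|p)·p`) [cite: IrelandRosen1990, Ch. 6 §3 Prop. 6.3.2];
L. Washington, *Introduction to Cyclotomic Fields*, §2 (`(ζ₈ + ζ₈⁻¹)² = 2`, so `√2 ∈ ℚ(ζ₈)`; `√(±p) ∈ ℚ(ζ_p)`)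
[cite: Washington1997, Ch. 2 (Lemma 2.? quadratic subfield of ℚ(ζ_p), exercise 2.?)]; J. Neukirch, *Algebraic
Number Theory*, Ch. IV §3 (Kummer theory) [cite: NeukirchANT1999, Ch. IV §3]; S. Mochizuki, [EtTh] §1 p. 13
(`K_N := K(ζ_N, q_X^{1/N})`) [cite: MochizukiEtTh2009, §1 p.13] — only as the locus where `κ_p`, `χ` are used.

abc-iut cell, seat abc-iut-w5-d089 (gen 9), home L6.  PROOF-ONLY over landed declarations (abc-iut-L2-t5's
`kappaP` / `pRoot` / `apply_pRoot` / `level_kappaP_eq_one_iff`, abc-iut-w5-d091's `chi` / `apply_eq_pow_levelChar_chi`,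
abc-iut-L2-t5's `cycGen` / `isPrimitiveRoot_coe_cycGen`, abc-iut-w4-d024's `ZHatLevel.levelChar`,
`SettingModelCyclotomicCharacterLevelNontrivial`'s `apply_eq_self_of_levelChar_chi_eq_one`; Mathlib's
`gaussSum_sq`, `quadraticChar`, `AddChar.zmodChar`): no definition, no instance, no `Prop`-valued fact.

WHAT THIS FILE PROVES (numbers, not adjectives), for every prime `p` (no parity / `p mod 4` hypothesis):
* `apply_eq_self_of_levelChar_chi_eq_one_of_dvd` — `χ_N(σ) = 1` ⇒ `σ` fixes every `d`-th root of unity,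
  `d ∣ N` (from abc-iut-w5-d091's `apply_eq_self_of_levelChar_chi_eq_one`, imported BY NAME);
* `apply_pRoot_two_of_fixed_of_pow_four_eq` — if `σ` fixes the 4-th roots of unity and some `t ≠ 0` with
  `t⁴ = p²`, then `σ` fixes the chosen `√p = pRoot p 2` (`√p / t` is a 4-th root of unity);
* `exists_fixed_pow_four_eq_sq_of_ne_two` — `p ≠ 2`: the Gauss sum `g` is such a `t` whenever `σ` fixes `μ_p`
  (`g⁴ = ((−1|p)·p)² = p²`); `exists_fixed_pow_four_eq_sq_of_eq_two` — `p = 2`: `t = ζ₈ + ζ₈⁻¹` (`t² = 2`);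
* **`apply_pRoot_two_of_levelChar_chi_eq_one`** — `4p ∣ N` and `χ_N(σ) = 1` ⇒ `σ(√p) = √p`, i.e.
  **`level_two_kappaP_eq_one_of_levelChar_chi_eq_one`**: `κ_p(σ) ≡ 0 (mod 2)` — "`√p ∈ ℚ_p(μ_{4p})`";
* `apply_pRoot_eq_iff_level_kappaP_eq` — `σ(p^{1/N}) = τ(p^{1/N}) ⟺ κ_p(σ) ≡ κ_p(τ) (mod N)`;
* **`level_two_kappaP_eq_of_levelChar_chi_eq`** — `4p ∣ N` and `χ_N(σ) = χ_N(τ)` ⇒ `κ_p(σ) ≡ κ_p(τ) (mod 2)`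
  (and the `zpow` form `level_two_kappaP_zpow_eq_of_levelChar_chi_eq` used by the stage-2 model files).

HONEST LABEL: classical facts about `ℚ̄_p`; a model is consistency evidence only; nothing here bears on
[IUTchIII] Cor. 3.12; nothing here says abc is proved or refuted.
-/

noncomputable section

open CategoryTheory ProfiniteGrp ProfiniteGrp.ProfiniteCompletion

namespace Literature.AnabelianGeometry.EtaleTheta.SettingModel

open Literature.AnabelianGeometry.SemiGraphs (GQp)

variable (p : ℕ) [Fact p.Prime]

/-! ### §1. `χ_N(σ) = 1` ⇒ `σ` fixes the `d`-th roots of unity, `d ∣ N` -/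

/-- `χ_N(σ) = 1` and `d ∣ N` ⇒ `σ(μ) = μ` for every `μ` with `μ^d = 1`. [cite: MochizukiEtTh2009, §1 p.13] -/
theorem apply_eq_self_of_levelChar_chi_eq_one_of_dvd {σ : GQp p} {N : ℕ+}
    (hχ : ZHatLevel.levelChar N (chi p σ) = 1) {d : ℕ} (hd : d ∣ (N : ℕ)) {μ : PadicAlgCl p} (hμ : μ ^ d = 1) :
    σ μ = μ := by
  obtain ⟨k, hk⟩ := hd
  exact apply_eq_self_of_levelChar_chi_eq_one p σ N (by rw [hk, pow_mul, hμ, one_pow]) hχ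

/-! ### §2. The `4`-th-root-of-unity trick -/

/-- `ℚ̄_p` has characteristic `0` (local copy of abc-iut-w5-d091's remark, as an instance-free `have`).
[cite: NeukirchANT1999, Ch. II §5] -/
private theorem charZero_padicAlgCl' : CharZero (PadicAlgCl p) :=
  charZero_of_injective_algebraMap (algebraMap ℚ_[p] (PadicAlgCl p)).injective

/-- **If `σ` fixes the `4`-th roots of unity and a nonzero `t` with `t⁴ = p²`, then `σ` fixes `√p = pRoot p 2`**:
`(√p / t)⁴ = p²/p² = 1`, so `√p = (√p/t) · t` is a product of two `σ`-fixed elements.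
[cite: IrelandRosen1990, Ch. 6 §3 Prop. 6.3.2] -/
theorem apply_pRoot_two_of_fixed_of_pow_four_eq {σ : GQp p} (h4 : ∀ μ : PadicAlgCl p, μ ^ 4 = 1 → σ μ = μ)
    {t : PadicAlgCl p} (ht : σ t = t) (ht0 : t ≠ 0) (ht4 : t ^ 4 = (p : PadicAlgCl p) ^ 2) :
    σ (pRoot p 2) = pRoot p 2 := by
  haveI := charZero_padicAlgCl' p
  have hp0 : (p : PadicAlgCl p) ≠ 0 := Nat.cast_ne_zero.mpr (Fact.out : p.Prime).ne_zero
  have h2 : pRoot p 2 ^ 2 = (p : PadicAlgCl p) := pRoot_pow p 2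
  have hμ : (pRoot p 2 / t) ^ 4 = 1 := by
    rw [div_pow, show pRoot p 2 ^ 4 = (pRoot p 2 ^ 2) ^ 2 by ring, h2, ht4, div_self (pow_ne_zero _ hp0)]
  have hdecomp : pRoot p 2 = pRoot p 2 / t * t := (div_mul_cancel₀ _ ht0).symm
  rw [hdecomp, map_mul, h4 _ hμ, ht]

/-! ### §3. `p ≠ 2`: the quadratic Gauss sum -/

/-- **`p` odd: a `σ`-fixed `t ≠ 0` with `t⁴ = p²` exists as soon as `σ` fixes `μ_p`** — the quadratic Gauss sum
`g = Σ_{a ∈ 𝔽_p} (a|p)·ζ_p^a ∈ ℤ[ζ_p]`, `g² = (−1|p)·p` (Mathlib `gaussSum_sq`), so `g⁴ = p²`, `g ≠ 0`.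
[cite: IrelandRosen1990, Ch. 6 §3 Prop. 6.3.2] -/
theorem exists_fixed_pow_four_eq_sq_of_ne_two (hp : p ≠ 2) {σ : GQp p}
    (hζ : ∀ μ : PadicAlgCl p, μ ^ p = 1 → σ μ = μ) :
    ∃ t : PadicAlgCl p, σ t = t ∧ t ≠ 0 ∧ t ^ 4 = (p : PadicAlgCl p) ^ 2 := by
  haveI := charZero_padicAlgCl' p
  haveI : NeZero p := ⟨(Fact.out : p.Prime).ne_zero⟩
  have hp0 : (p : PadicAlgCl p) ≠ 0 := Nat.cast_ne_zero.mpr (Fact.out : p.Prime).ne_zero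
  -- a primitive `p`-th root of unity `ζ` and the additive character `a ↦ ζ^a` of `𝔽_p`
  set ζ : PadicAlgCl p := (((cycGen p : ℕ+ → (PadicAlgCl p)ˣ) ⟨p, (Fact.out : p.Prime).pos⟩ : (PadicAlgCl p)ˣ) :
    PadicAlgCl p) with hζdef
  have hζprim : IsPrimitiveRoot ζ p := isPrimitiveRoot_coe_cycGen p ⟨p, (Fact.out : p.Prime).pos⟩
  have hζp : ζ ^ p = 1 := hζprim.pow_eq_one
  have hσζ : σ ζ = ζ := hζ ζ hζp
  set ψ : AddChar (ZMod p) (PadicAlgCl p) := AddChar.zmodChar p hζp with hψdef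
  have hψ : ψ.IsPrimitive := AddChar.zmodChar_primitive_of_primitive_root p hζprim
  -- the quadratic character of `𝔽_p` with values in `ℚ̄_p`
  set χq : MulChar (ZMod p) (PadicAlgCl p) :=
    (quadraticChar (ZMod p)).ringHomComp (Int.castRingHom (PadicAlgCl p)) with hχqdef
  have hinj : Function.Injective (Int.castRingHom (PadicAlgCl p)) := Int.cast_injective
  have hχ1 : χq ≠ 1 := by
    rw [hχqdef, MulChar.ringHomComp_ne_one_iff hinj]
    exact quadraticChar_ne_one (by rw [ZMod.ringChar_zmod_n]; exact hp)
  have hχ2 : χq.IsQuadratic := (quadraticChar_isQuadratic (ZMod p)).comp _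
  -- the Gauss sum and its square
  set g : PadicAlgCl p := gaussSum χq ψ with hgdef
  have hg : g ^ 2 = χq (-1) * (p : PadicAlgCl p) := by
    rw [hgdef, gaussSum_sq hχ1 hχ2 hψ, ZMod.card]
  set ε : PadicAlgCl p := χq (-1) with hεdef
  have hε : ε * ε = 1 := by
    rw [hεdef, ← map_mul, neg_one_mul, neg_neg, map_one]
  have hε0 : ε ≠ 0 := fun h => by rw [h, zero_mul] at hε; exact zero_ne_one hε
  refine ⟨g, ?_, ?_, ?_⟩
  · -- `σ g = g`: `g` is an integral combination of powers of `ζ`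
    rw [hgdef, gaussSum, map_sum]
    refine Finset.sum_congr rfl fun a _ => ?_
    rw [map_mul, hχqdef, MulChar.ringHomComp_apply, Int.coe_castRingHom, map_intCast, hψdef,
      AddChar.zmodChar_apply, map_pow, hσζ]
  · intro h0
    have : ε * (p : PadicAlgCl p) = 0 := by rw [hεdef, ← hg, h0]; ring
    exact mul_ne_zero hε0 hp0 this
  · calc g ^ 4 = (g ^ 2) ^ 2 := by ring
      _ = (ε * (p : PadicAlgCl p)) ^ 2 := by rw [hg]
      _ = (p : PadicAlgCl p) ^ 2 := by rw [mul_pow, sq ε, hε, one_mul]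

/-! ### §4. `p = 2`: `ζ₈ + ζ₈⁻¹` -/

/-- **`p = 2`: a `σ`-fixed `t ≠ 0` with `t⁴ = p² = 4` exists as soon as `σ` fixes `μ₈`** — `t = ζ₈ + ζ₈⁻¹`,
`t² = 2` (`ζ₈⁴ = −1`). [cite: Washington1997, Ch. 2 (√2 = ζ₈ + ζ₈⁻¹ ∈ ℚ(ζ₈))] -/
theorem exists_fixed_pow_four_eq_sq_of_eq_two (hp : p = 2) {σ : GQp p}
    (h8 : ∀ μ : PadicAlgCl p, μ ^ 8 = 1 → σ μ = μ) :
    ∃ t : PadicAlgCl p, σ t = t ∧ t ≠ 0 ∧ t ^ 4 = (p : PadicAlgCl p) ^ 2 := by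
  haveI := charZero_padicAlgCl' p
  set ω : PadicAlgCl p := (((cycGen p : ℕ+ → (PadicAlgCl p)ˣ) 8 : (PadicAlgCl p)ˣ) : PadicAlgCl p) with hωdef
  have hωprim : IsPrimitiveRoot ω 8 := isPrimitiveRoot_coe_cycGen p 8
  have hω8 : ω ^ 8 = 1 := hωprim.pow_eq_one
  have hω0 : ω ≠ 0 := hωprim.ne_zero (by norm_num)
  have hω4 : ω ^ 4 = -1 :=
    (hωprim.pow (by norm_num) (show 8 = 4 * 2 by norm_num)).eq_neg_one_of_two_right
  have hσω : σ ω = ω := h8 ω hω8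
  have ht2 : (ω + ω⁻¹) ^ 2 = 2 := by
    field_simp
    linear_combination hω4
  refine ⟨ω + ω⁻¹, ?_, ?_, ?_⟩
  · rw [map_add, map_inv₀, hσω]
  · intro h0
    rw [h0] at ht2
    norm_num at ht2
  · have hp' : (p : PadicAlgCl p) = 2 := by
      rw [show (p : PadicAlgCl p) = ((2 : ℕ) : PadicAlgCl p) from congrArg Nat.cast hp, Nat.cast_ofNat]
    rw [show (ω + ω⁻¹) ^ 4 = ((ω + ω⁻¹) ^ 2) ^ 2 by ring, ht2, hp']

/-! ### §5. `√p ∈ ℚ_p(μ_{4p})` -/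

/-- **`4p ∣ N` and `χ_N(σ) = 1` ⇒ `σ(√p) = √p`** for the chosen `√p = pRoot p 2 ∈ ℚ̄_p` (every prime `p`):
"`√p ∈ ℚ_p(μ_{4p})`". [cite: IrelandRosen1990, Ch. 6 §3 Prop. 6.3.2] -/
theorem apply_pRoot_two_of_levelChar_chi_eq_one {σ : GQp p} {N : ℕ+} (hN : 4 * p ∣ (N : ℕ))
    (hχ : ZHatLevel.levelChar N (chi p σ) = 1) : σ (pRoot p 2) = pRoot p 2 := by
  have h4 : ∀ μ : PadicAlgCl p, μ ^ 4 = 1 → σ μ = μ := fun μ hμ =>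
    apply_eq_self_of_levelChar_chi_eq_one_of_dvd p hχ (dvd_trans (dvd_mul_right 4 p) hN) hμ
  by_cases hp : p = 2
  · have h8 : ∀ μ : PadicAlgCl p, μ ^ 8 = 1 → σ μ = μ := fun μ hμ =>
      apply_eq_self_of_levelChar_chi_eq_one_of_dvd p hχ (by rw [hp] at hN; exact hN) hμ
    obtain ⟨t, ht, ht0, ht4⟩ := exists_fixed_pow_four_eq_sq_of_eq_two p hp h8
    exact apply_pRoot_two_of_fixed_of_pow_four_eq p h4 ht ht0 ht4
  · have hζ : ∀ μ : PadicAlgCl p, μ ^ p = 1 → σ μ = μ := fun μ hμ =>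
      apply_eq_self_of_levelChar_chi_eq_one_of_dvd p hχ (dvd_trans (dvd_mul_left p 4) hN) hμ
    obtain ⟨t, ht, ht0, ht4⟩ := exists_fixed_pow_four_eq_sq_of_ne_two p hp hζ
    exact apply_pRoot_two_of_fixed_of_pow_four_eq p h4 ht ht0 ht4

/-- **`4p ∣ N` and `χ_N(σ) = 1` ⇒ `κ_p(σ) ≡ 0 (mod 2)`.** [cite: NeukirchANT1999, Ch. IV §3] -/
theorem level_two_kappaP_eq_one_of_levelChar_chi_eq_one {σ : GQp p} {N : ℕ+} (hN : 4 * p ∣ (N : ℕ))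
    (hχ : ZHatLevel.levelChar N (chi p σ) = 1) : ZHatLevel.level 2 (kappaP p σ) = 1 :=
  (level_kappaP_eq_one_iff p σ 2).mpr (apply_pRoot_two_of_levelChar_chi_eq_one p hN hχ)

/-! ### §6. Pair forms: `χ_N(σ) = χ_N(τ)` ⇒ `κ_p(σ) ≡ κ_p(τ) (mod 2)` -/

/-- `σ(p^{1/N}) = τ(p^{1/N}) ⟺ κ_p(σ) ≡ κ_p(τ) (mod N)` (both sides are `ξ_N^{κ mod N} · p^{1/N}` with `ξ_N`
primitive). [cite: NeukirchANT1999, Ch. IV §3] -/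
theorem apply_pRoot_eq_iff_level_kappaP_eq (σ τ : GQp p) (N : ℕ+) :
    σ (pRoot p N) = τ (pRoot p N) ↔ ZHatLevel.level N (kappaP p σ) = ZHatLevel.level N (kappaP p τ) := by
  constructor
  · intro h
    rw [apply_pRoot p σ N, apply_pRoot p τ N] at h
    have h' := mul_right_cancel₀ (pRoot_ne_zero p N) h
    have hinj := (isPrimitiveRoot_coe_cycGen p N).pow_inj (ZMod.val_lt _) (ZMod.val_lt _) h'
    exact Multiplicative.toAdd.injective (ZMod.val_injective N hinj)
  · intro h
    rw [apply_pRoot p σ N, apply_pRoot p τ N, h]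

/-- `χ_N(σ) = χ_N(τ)` ⇒ `χ_N(σ⁻¹τ) = 1`. [cite: MochizukiEtTh2009, §1 p.13] -/
theorem levelChar_chi_inv_mul_eq_one {σ τ : GQp p} {N : ℕ+}
    (h : ZHatLevel.levelChar N (chi p σ) = ZHatLevel.levelChar N (chi p τ)) :
    ZHatLevel.levelChar N (chi p (σ⁻¹ * τ)) = 1 := by
  rw [map_mul, map_inv, map_mul, ← h, mul_comm, ZHatLevel.levelChar_mul_levelChar_inv]

/-- **`4p ∣ N` and `χ_N(σ) = χ_N(τ)` ⇒ `σ(√p) = τ(√p)`.** [cite: IrelandRosen1990, Ch. 6 §3 Prop. 6.3.2] -/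
theorem apply_pRoot_two_eq_of_levelChar_chi_eq {σ τ : GQp p} {N : ℕ+} (hN : 4 * p ∣ (N : ℕ))
    (h : ZHatLevel.levelChar N (chi p σ) = ZHatLevel.levelChar N (chi p τ)) :
    σ (pRoot p 2) = τ (pRoot p 2) := by
  have hfix := apply_pRoot_two_of_levelChar_chi_eq_one p hN (levelChar_chi_inv_mul_eq_one p h)
  rw [AlgEquiv.mul_apply] at hfix
  have h' := congrArg σ hfix
  rw [← AlgEquiv.mul_apply, mul_inv_cancel, AlgEquiv.one_apply] at h'
  exact h'.symm

/-- **`4p ∣ N` and `χ_N(σ) = χ_N(τ)` ⇒ `κ_p(σ) ≡ κ_p(τ) (mod 2)`** — the level-`2` Kummer class of `q̈ = p`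
factors through the mod-`4p` cyclotomic character. [cite: NeukirchANT1999, Ch. IV §3] -/
theorem level_two_kappaP_eq_of_levelChar_chi_eq {σ τ : GQp p} {N : ℕ+} (hN : 4 * p ∣ (N : ℕ))
    (h : ZHatLevel.levelChar N (chi p σ) = ZHatLevel.levelChar N (chi p τ)) :
    ZHatLevel.level 2 (kappaP p σ) = ZHatLevel.level 2 (kappaP p τ) :=
  (apply_pRoot_eq_iff_level_kappaP_eq p σ τ 2).mp (apply_pRoot_two_eq_of_levelChar_chi_eq p hN h)

/-- The `zpow` form: `4p ∣ N` and `χ_N(σ) = χ_N(τ)` ⇒ `level 2 (κ_p(σ)^i) = level 2 (κ_p(τ)^i)` for every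
`i : ℤ` (the shape `κ₂(σ)^i = κ₂(νσ)^i` of the stage-2 model files). [cite: NeukirchANT1999, Ch. IV §3] -/
theorem level_two_kappaP_zpow_eq_of_levelChar_chi_eq {σ τ : GQp p} {N : ℕ+} (hN : 4 * p ∣ (N : ℕ))
    (h : ZHatLevel.levelChar N (chi p σ) = ZHatLevel.levelChar N (chi p τ)) (i : ℤ) :
    ZHatLevel.level 2 (kappaP p σ ^ i) = ZHatLevel.level 2 (kappaP p τ ^ i) := by
  rw [map_zpow, map_zpow, level_two_kappaP_eq_of_levelChar_chi_eq p hN h]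

end Literature.AnabelianGeometry.EtaleTheta.SettingModel

end
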